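import Mathlib.RingTheory.MvPolynomial.Homogeneous
import Mathlib.Algebra.MvPolynomial.Monad
import Mathlib.LinearAlgebra.Matrix.ToLin
import Mathlib.Data.Matrix.Mul
import HarnessLib

/-!
# The symmetric-power matrices `Symⁿ(M)` on binary forms and Hida's contraction modulo `p`

First file of the cohomological proof of the deep half of Hida's rank constancy
(Hida, *Elementary Modular Iwasawa Theory* (2022), Lemma 4.1.25 = Cor. 4.2.32; the method is the
"contraction" of the `U_p`-operator on group cohomology with coefficients in `Symⁿ` reduced
modulo `p`: Hida, *Elementary Modular Iwasawa Theory*, §4.2.11 "Weight comparison", (4.40) and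
the injection `I = i_*`, first proven in Hida, Ann. Sci. ENS 19 (1986), Thm. 4.4), serving the
named fact
`Literature.NumberTheory.EllipticCurves.hida_exists_congruent_ordinary_newform`
(`HidaFamilyMembers.lean`).  This file is pure commutative algebra over an arbitrary commutative
ring `R`:

* `toPoly n a = ∑ᵢ aᵢ X₀^{n-i} X₁^{i}` identifies coefficient vectors `a ∈ R^{n+1}` with binary
  forms of degree `n` (`coeff_toPoly`, `toPoly_injective`, `eq_toPoly_of_isHomogeneous`);
* `linSubst M` is the substitution `X_i ↦ ∑_k M_{ik} X_k` of a `2 × 2` matrix `M`, so that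
  `eval p (linSubst M P) = eval (M p) P` (`eval_linSubst`) and
  `linSubst (M M') = linSubst M' ∘ linSubst M` (`linSubst_mul`);
* `symPow n M ∈ M_{n+1}(R)`, the matrix of `linSubst M` on forms of degree `n` in the monomial
  basis (`toPoly_symPow_mulVec`), an ANTI-representation: `symPow n (M M') = symPow n M' symPow n M`
  (`symPow_mul`), `symPow n 1 = 1`, compatible with ring homomorphisms (`symPow_map`) and with
  evaluation: `evalVec n (symPow n M a) p = evalVec n a (M p)` (`evalVec_symPow_mulVec`), where
  `evalVec n a p = ∑ᵢ aᵢ p₀^{n-i} p₁^{i}`.  This is the right action `F ↦ F(M ·)` on homogeneous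
  functions of `p = (u, v)` in which the tree's Eichler–Shimura period cocycles are written
  (`EichlerShimuraPeriods`: `c(γδ)(p) = c(δ)(p) + c(γ)(δp)`), transported to coefficients;
* **Hida's contraction** (Hida, *EMI* §4.2.11: the map `i : P(X, Y) ↦ P(1, 0)` of (4.40) is a
  morphism of `Γ₀(p)`-modules, its kernel `L(n-1)·Y` is killed by the `(1 u; 0 p)` modulo `p`,
  so `U(p)` kills it; first in Hida 1986, Thm. 4.4): for a matrix
  with `M₁₀ = 0` the `u^n`-coefficient transforms by `M₀₀^n`
  (`symPow_mulVec_apply_zero`), and for a matrix whose second row vanishes — the shape of the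
  Hecke representatives `(1 j; 0 p)` modulo `p` — the whole action factors through the
  `u^n`-coefficient (`symPow_mulVec_of_row_one_eq_zero`); in particular it kills the forms with
  vanishing `u^n`-coefficient.

Everything is proved; no named facts.  (A parallel, covariant version of `symPow` with the
transposed substitution exists in a `Summits/Langlands` theorems file, which Literature may not
import; the present development is self-contained.)

## References

* H. Hida, *Elementary Modular Iwasawa Theory*, World Scientific 2022, §4.2.11 "Weight
  comparison" ((4.40), (4.41), Thm. 4.2.24), Lemma 4.1.25, Cor. 4.2.32. [Hida2022EMI]
* H. Hida, *Iwasawa modules attached to congruences of cusp forms*, Ann. Sci. ENS 19 (1986),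
  231–273, Thm. 4.4. [Hida1986ENS]
* H. Hida, *Elementary Theory of `L`-functions and Eisenstein Series*, LMS Student Texts 26,
  CUP 1993, Ch. 7 (the `Λ`-adic theory these rank statements feed). [Hida1993LFE]
* W. Fulton, J. Harris, *Representation Theory*, GTM 129, §11.1 (`Symⁿ` of the standard
  representation). [folklore]
-/

noncomputable section

open MvPolynomial Finsupp Matrix

namespace Literature.NumberTheory.EllipticCurves.ModularForms.HidaCohomology

variable {R : Type*} [CommRing R]

/-! ### Binary forms of degree `n` and their coefficient vectors -/

/-- The exponent vector `(n - i, i)` of the monomial `X₀^{n-i} X₁^{i}`. [folklore] -/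
def expVec (n i : ℕ) : Fin 2 →₀ ℕ := single 0 (n - i) + single 1 i

/-- `expVec n i 0 = n - i`. [folklore] -/
@[simp] theorem expVec_apply_zero (n i : ℕ) : expVec n i 0 = n - i := by simp [expVec]

/-- `expVec n i 1 = i`. [folklore] -/
@[simp] theorem expVec_apply_one (n i : ℕ) : expVec n i 1 = i := by simp [expVec]

/-- `i ↦ expVec n i` is injective (read off the `X₁`-exponent). [folklore] -/
theorem expVec_injective (n : ℕ) {i i' : ℕ} (h : expVec n i = expVec n i') : i = i' := by
  have := congrArg (fun d : Fin 2 →₀ ℕ ↦ d 1) h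
  simpa using this

/-- The degree of `expVec n i` is `n` for `i ≤ n`. [folklore] -/
theorem degree_expVec {n i : ℕ} (hi : i ≤ n) : (expVec n i).degree = n := by
  rw [expVec, map_add, degree_single, degree_single]
  omega

/-- `X₀^{n-i} X₁^{i}` is the monomial with exponent vector `expVec n i`. [folklore] -/
theorem X_pow_mul_X_pow_eq_monomial (n i : ℕ) :
    (X 0 ^ (n - i) * X 1 ^ i : MvPolynomial (Fin 2) R) = monomial (expVec n i) 1 := by
  rw [X_pow_eq_monomial, X_pow_eq_monomial, monomial_mul, one_mul]
  rfl

/-- `X₀^{n-i} X₁^{i}` is homogeneous of degree `n` (`i ≤ n`). [folklore] -/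
theorem isHomogeneous_X_pow_mul_X_pow {n i : ℕ} (hi : i ≤ n) :
    (X 0 ^ (n - i) * X 1 ^ i : MvPolynomial (Fin 2) R).IsHomogeneous n := by
  rw [X_pow_mul_X_pow_eq_monomial]
  exact isHomogeneous_monomial _ (degree_expVec hi)

variable (n : ℕ)

/-- **The binary form with coefficient vector `a`**: `toPoly n a = ∑ᵢ aᵢ X₀^{n-i} X₁^{i}`.
[folklore] -/
def toPoly : (Fin (n + 1) → R) →ₗ[R] MvPolynomial (Fin 2) R where
  toFun a := ∑ i : Fin (n + 1), C (a i) * (X 0 ^ (n - i) * X 1 ^ (i : ℕ))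
  map_add' a b := by
    simp only [Pi.add_apply, map_add, add_mul, Finset.sum_add_distrib]
  map_smul' c a := by
    simp only [Pi.smul_apply, smul_eq_mul, map_mul, RingHom.id_apply, Finset.mul_sum, mul_assoc,
      smul_eq_C_mul]

variable {n}

/-- Unfolding `toPoly`. [folklore] -/
theorem toPoly_apply (a : Fin (n + 1) → R) :
    toPoly n a = ∑ i : Fin (n + 1), C (a i) * (X 0 ^ (n - i) * X 1 ^ (i : ℕ)) := rfl

/-- `toPoly n a` is homogeneous of degree `n`. [folklore] -/
theorem isHomogeneous_toPoly (a : Fin (n + 1) → R) : (toPoly n a).IsHomogeneous n := by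
  rw [toPoly_apply]
  refine IsHomogeneous.sum _ _ _ fun i _ ↦ ?_
  have h := (isHomogeneous_X_pow_mul_X_pow (R := R) (n := n) (i := i) (by have := i.2; omega))
  simpa using (isHomogeneous_C (Fin 2) (a i)).mul h

/-- **The coefficients of `toPoly n a` are the `aᵢ`.** [folklore] -/
theorem coeff_toPoly (a : Fin (n + 1) → R) (i : Fin (n + 1)) :
    coeff (expVec n i) (toPoly n a) = a i := by
  classical
  rw [toPoly_apply, coeff_sum]
  simp only [X_pow_mul_X_pow_eq_monomial, coeff_C_mul, coeff_monomial, mul_ite, mul_one, mul_zero]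
  rw [Finset.sum_eq_single i]
  · rw [if_pos rfl]
  · intro j _ hj
    rw [if_neg]
    intro h
    exact hj (Fin.ext (expVec_injective n h))
  · exact fun h ↦ absurd (Finset.mem_univ _) h

/-- A coefficient of `toPoly n a` off the exponent vectors `expVec n i` vanishes. [folklore] -/
theorem coeff_toPoly_eq_zero (a : Fin (n + 1) → R) {d : Fin 2 →₀ ℕ}
    (hd : ∀ i : Fin (n + 1), d ≠ expVec n i) : coeff d (toPoly n a) = 0 := by
  classical
  rw [toPoly_apply, coeff_sum]
  simp only [X_pow_mul_X_pow_eq_monomial, coeff_C_mul, coeff_monomial, mul_ite, mul_one, mul_zero]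
  exact Finset.sum_eq_zero fun i _ ↦ if_neg fun h ↦ hd i h.symm

/-- `toPoly n` is injective. [folklore] -/
theorem toPoly_injective : Function.Injective (toPoly n (R := R)) := by
  intro a b h
  funext i
  rw [← coeff_toPoly a i, ← coeff_toPoly b i, h]

/-- **Expansion of a binary form of degree `n` in the monomial basis**: a homogeneous `P` of
degree `n` is `toPoly n (i ↦ coeff_{(n-i, i)} P)`. [folklore] -/
theorem eq_toPoly_of_isHomogeneous {P : MvPolynomial (Fin 2) R} (hP : P.IsHomogeneous n) :
    P = toPoly n fun i ↦ coeff (expVec n i) P := by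
  classical
  refine MvPolynomial.ext _ _ fun d ↦ ?_
  by_cases hd : d.degree = n
  · -- `d = (n - i, i)` with `i = d 1 ≤ n`
    have hd2 : d 0 + d 1 = n := by rw [← hd, degree_eq_sum, Fin.sum_univ_two]
    have hdi : d = expVec n (d 1) := by
      ext k
      fin_cases k
      · simp; omega
      · simp
    have hlt : d 1 < n + 1 := by omega
    have : d = expVec n ((⟨d 1, hlt⟩ : Fin (n + 1)) : ℕ) := hdi
    rw [this, coeff_toPoly]
  · rw [hP.coeff_eq_zero hd, coeff_toPoly_eq_zero]
    intro i h
    apply hd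
    rw [h]
    exact degree_expVec (by have := i.2; omega)

/-! ### The linear substitution of a `2 × 2` matrix -/

/-- **The substitution `X_i ↦ ∑_k M_{ik} X_k`** attached to a `2 × 2` matrix `M`; on functions of
`p = (u, v)` it is `F ↦ F(M p)` (`eval_linSubst`). [folklore] -/
def linSubst (M : Matrix (Fin 2) (Fin 2) R) : MvPolynomial (Fin 2) R →ₐ[R] MvPolynomial (Fin 2) R :=
  bind₁ fun i : Fin 2 ↦ ∑ k : Fin 2, C (M i k) * X k

/-- `linSubst M (X i) = ∑_k M_{ik} X_k`. [folklore] -/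
theorem linSubst_X (M : Matrix (Fin 2) (Fin 2) R) (i : Fin 2) :
    linSubst M (X i) = ∑ k : Fin 2, C (M i k) * X k := by
  rw [linSubst, bind₁_X_right]

/-- `linSubst M (C r) = C r`. [folklore] -/
@[simp] theorem linSubst_C (M : Matrix (Fin 2) (Fin 2) R) (r : R) : linSubst M (C r) = C r := by
  rw [linSubst, bind₁_C_right]

/-- **`eval p (linSubst M P) = eval (M p) P`.** [folklore] -/
theorem eval_linSubst (M : Matrix (Fin 2) (Fin 2) R) (P : MvPolynomial (Fin 2) R) (p : Fin 2 → R) :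
    eval p (linSubst M P) = eval (M.mulVec p) P := by
  simp only [linSubst]
  change eval₂Hom (RingHom.id R) p (bind₁ _ P) = eval₂Hom (RingHom.id R) (M.mulVec p) P
  rw [eval₂Hom_bind₁]
  have hg : (fun i : Fin 2 ↦ eval₂Hom (RingHom.id R) p (∑ k : Fin 2, C (M i k) * X k)) = M.mulVec p := by
    funext i
    simp [Matrix.mulVec, dotProduct, Fin.sum_univ_two]
  rw [hg]

/-- **`linSubst (M M') = linSubst M' ∘ linSubst M`** (an anti-homomorphism). [folklore] -/
theorem linSubst_mul (M M' : Matrix (Fin 2) (Fin 2) R) (P : MvPolynomial (Fin 2) R) :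
    linSubst (M * M') P = linSubst M' (linSubst M P) := by
  simp only [linSubst]
  rw [bind₁_bind₁]
  have h : (fun i : Fin 2 ↦ ∑ k : Fin 2, C ((M * M') i k) * X k) =
      fun i : Fin 2 ↦ bind₁ (fun i : Fin 2 ↦ ∑ k : Fin 2, C (M' i k) * X k) (∑ k : Fin 2, C (M i k) * X k) := by
    funext i
    simp only [map_sum, map_mul, bind₁_C_right, bind₁_X_right, Matrix.mul_apply, map_sum (C),
      Finset.sum_mul, Finset.mul_sum, map_mul (C)]
    rw [Finset.sum_comm]
    refine Finset.sum_congr rfl fun k _ ↦ Finset.sum_congr rfl fun l _ ↦ ?_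
    ring
  rw [h]

/-- `linSubst 1 = id`. [folklore] -/
theorem linSubst_one (P : MvPolynomial (Fin 2) R) : linSubst (1 : Matrix (Fin 2) (Fin 2) R) P = P := by
  have h : (fun i : Fin 2 ↦ ∑ k : Fin 2, C ((1 : Matrix (Fin 2) (Fin 2) R) i k) * X k) = X := by
    funext i
    fin_cases i <;> simp [Matrix.one_apply]
  rw [linSubst, h, bind₁_X_left, AlgHom.id_apply]

/-- A linear substitution preserves homogeneity of each degree. [folklore] -/
theorem isHomogeneous_linSubst (M : Matrix (Fin 2) (Fin 2) R) {P : MvPolynomial (Fin 2) R} {m : ℕ}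
    (hP : P.IsHomogeneous m) : (linSubst M P).IsHomogeneous m := by
  have h := hP.aeval (fun i : Fin 2 ↦ ∑ k : Fin 2, C (M i k) * X k) (n := 1) fun i ↦ ?_
  · simpa [linSubst] using h
  · refine IsHomogeneous.sum _ _ _ fun k _ ↦ ?_
    simpa using (isHomogeneous_C (Fin 2) (M i k)).mul (isHomogeneous_X R k)

/-- Compatibility of `linSubst` with a ring homomorphism on coefficients. [folklore] -/
theorem map_linSubst {S : Type*} [CommRing S] (f : R →+* S) (M : Matrix (Fin 2) (Fin 2) R)
    (P : MvPolynomial (Fin 2) R) :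
    map f (linSubst M P) = linSubst (M.map f) (map f P) := by
  rw [linSubst, linSubst, map_bind₁]
  have h : (fun i : Fin 2 ↦ map f (∑ k : Fin 2, C (M i k) * X k)) =
      fun i : Fin 2 ↦ ∑ k : Fin 2, C (M.map f i k) * X k := by
    funext i
    simp [Matrix.map_apply]
  rw [h]

/-! ### The symmetric-power matrices -/

variable (n)

/-- **The `n`-th symmetric power of `M`** in the monomial basis: `symPow n M i j` is the
coefficient of `X₀^{n-i} X₁^{i}` in `linSubst M (X₀^{n-j} X₁^{j})`. [folklore] -/
def symPow (M : Matrix (Fin 2) (Fin 2) R) : Matrix (Fin (n + 1)) (Fin (n + 1)) R :=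
  fun i j ↦ coeff (expVec n i) (linSubst M (X 0 ^ (n - j) * X 1 ^ (j : ℕ)))

variable {n}

/-- The substituted monomial expands with the `j`-th column of `symPow n M`. [folklore] -/
theorem linSubst_monomial_eq_toPoly (M : Matrix (Fin 2) (Fin 2) R) (j : Fin (n + 1)) :
    linSubst M (X 0 ^ (n - j) * X 1 ^ (j : ℕ)) = toPoly n fun i ↦ symPow n M i j := by
  have hhom := isHomogeneous_linSubst M
    (isHomogeneous_X_pow_mul_X_pow (R := R) (n := n) (i := j) (by have := j.2; omega))
  conv_lhs => rw [eq_toPoly_of_isHomogeneous hhom]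
  rfl

/-- **`symPow n M` is the matrix of `linSubst M` on binary forms of degree `n`:**
`toPoly n (symPow n M a) = linSubst M (toPoly n a)`. [folklore] -/
theorem toPoly_symPow_mulVec (M : Matrix (Fin 2) (Fin 2) R) (a : Fin (n + 1) → R) :
    toPoly n (symPow n M *ᵥ a) = linSubst M (toPoly n a) := by
  rw [toPoly_apply a, map_sum]
  have hterm : ∀ j : Fin (n + 1), linSubst M (C (a j) * (X 0 ^ (n - j) * X 1 ^ (j : ℕ))) =
      C (a j) * toPoly n (fun i ↦ symPow n M i j) := by
    intro j
    rw [map_mul, linSubst_C, linSubst_monomial_eq_toPoly]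
  simp only [hterm]
  have : symPow n M *ᵥ a = ∑ j : Fin (n + 1), a j • fun i ↦ symPow n M i j := by
    funext i
    simp [Matrix.mulVec, dotProduct, Finset.sum_apply, mul_comm]
  rw [this, map_sum]
  refine Finset.sum_congr rfl fun j _ ↦ ?_
  rw [map_smul, smul_eq_C_mul]

/-- **Multiplicativity (anti)**: `symPow n (M M') = symPow n M' * symPow n M`. [folklore] -/
theorem symPow_mul (M M' : Matrix (Fin 2) (Fin 2) R) : symPow n (M * M') = symPow n M' * symPow n M := by
  apply Matrix.toLin'.injective
  apply (Pi.basisFun R (Fin (n + 1))).ext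
  intro j
  apply toPoly_injective
  rw [Matrix.toLin'_apply, Matrix.toLin'_apply, ← Matrix.mulVec_mulVec, toPoly_symPow_mulVec,
    toPoly_symPow_mulVec, toPoly_symPow_mulVec, linSubst_mul]

/-- `symPow n 1 = 1`. [folklore] -/
theorem symPow_one : symPow n (1 : Matrix (Fin 2) (Fin 2) R) = 1 := by
  apply Matrix.toLin'.injective
  apply (Pi.basisFun R (Fin (n + 1))).ext
  intro j
  apply toPoly_injective
  rw [Matrix.toLin'_apply, Matrix.toLin'_apply, toPoly_symPow_mulVec, linSubst_one, Matrix.one_mulVec]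

/-- **Compatibility with ring homomorphisms**: `symPow n (M.map f) = (symPow n M).map f`.
[folklore] -/
theorem symPow_map {S : Type*} [CommRing S] (f : R →+* S) (M : Matrix (Fin 2) (Fin 2) R) :
    symPow n (M.map f) = (symPow n M).map f := by
  ext i j
  simp only [symPow, Matrix.map_apply]
  have : (X 0 ^ (n - (j : ℕ)) * X 1 ^ (j : ℕ) : MvPolynomial (Fin 2) S) =
      map f (X 0 ^ (n - (j : ℕ)) * X 1 ^ (j : ℕ)) := by simp
  rw [this, ← map_linSubst, coeff_map]

variable (n)

/-- **Evaluation of a binary form at a point** `p = (u, v)`: `evalVec n a p = ∑ᵢ aᵢ u^{n-i} vⁱ`.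
[folklore] -/
def evalVec (a : Fin (n + 1) → R) (p : Fin 2 → R) : R :=
  ∑ i : Fin (n + 1), a i * p 0 ^ (n - i) * p 1 ^ (i : ℕ)

variable {n}

/-- `evalVec n a p = eval p (toPoly n a)`. [folklore] -/
theorem evalVec_eq_eval (a : Fin (n + 1) → R) (p : Fin 2 → R) : evalVec n a p = eval p (toPoly n a) := by
  simp [evalVec, toPoly_apply, map_sum, mul_assoc]

/-- **`evalVec` intertwines `symPow` with the substitution `p ↦ M p`:**
`evalVec n (symPow n M a) p = evalVec n a (M p)`. [folklore] -/
theorem evalVec_symPow_mulVec (M : Matrix (Fin 2) (Fin 2) R) (a : Fin (n + 1) → R) (p : Fin 2 → R) :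
    evalVec n (symPow n M *ᵥ a) p = evalVec n a (M *ᵥ p) := by
  rw [evalVec_eq_eval, evalVec_eq_eval, toPoly_symPow_mulVec, eval_linSubst]

/-- `evalVec` is linear in the coefficient vector: additivity. [folklore] -/
theorem evalVec_add (a b : Fin (n + 1) → R) (p : Fin 2 → R) :
    evalVec n (a + b) p = evalVec n a p + evalVec n b p := by
  simp [evalVec, add_mul, Finset.sum_add_distrib]

/-- `evalVec` is linear in the coefficient vector: homogeneity. [folklore] -/
theorem evalVec_smul (c : R) (a : Fin (n + 1) → R) (p : Fin 2 → R) :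
    evalVec n (c • a) p = c * evalVec n a p := by
  simp [evalVec, Finset.mul_sum, mul_assoc]

/-- `evalVec n 0 p = 0`. [folklore] -/
@[simp] theorem evalVec_zero (p : Fin 2 → R) : evalVec n (0 : Fin (n + 1) → R) p = 0 := by
  simp [evalVec]

/-- Compatibility of `evalVec` with a ring homomorphism. [folklore] -/
theorem map_evalVec {S : Type*} [CommRing S] (f : R →+* S) (a : Fin (n + 1) → R) (p : Fin 2 → R) :
    f (evalVec n a p) = evalVec n (f ∘ a) (f ∘ p) := by
  simp [evalVec, map_sum]

/-! ### Upper triangular matrices and Hida's contraction -/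

/-- The coefficient of `X₁^m` in `(a X₀ + b X₁)^m` is `b^m`. [folklore] -/
theorem coeff_single_one_linear_pow (a b : R) (m : ℕ) :
    coeff (single 1 m) ((C a * X 0 + C b * X 1 : MvPolynomial (Fin 2) R) ^ m) = b ^ m := by
  classical
  induction m with
  | zero => simp
  | succ m ih =>
    rw [pow_succ, mul_add, ← mul_assoc, ← mul_assoc, coeff_add, coeff_mul_X', coeff_mul_X',
      if_neg (by simp), if_pos (by simp), zero_add, mul_comm _ (C b), coeff_C_mul,
      ← Finsupp.single_tsub, Nat.add_sub_cancel, ih, pow_succ, mul_comm]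

/-- For `M` with `M₁₀ = 0`: `linSubst M (X₀^{n-j} X₁^{j}) = M₁₁^{j} X₁^{j} · (M₀₀ X₀ + M₀₁ X₁)^{n-j}`.
[folklore] -/
theorem linSubst_monomial_of_apply_one_zero {M : Matrix (Fin 2) (Fin 2) R} (hM : M 1 0 = 0) (j : ℕ) :
    linSubst M (X 0 ^ (n - j) * X 1 ^ j) =
      monomial (single 1 j) (M 1 1 ^ j) * (C (M 0 0) * X 0 + C (M 0 1) * X 1) ^ (n - j) := by
  simp only [map_mul, map_pow, linSubst_X, Fin.sum_univ_two, hM, C_0, zero_mul, zero_add]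
  rw [mul_pow, ← map_pow, X_pow_eq_monomial, C_mul_monomial, mul_one, mul_comm]

/-- The coefficient of `X₀^{m-i} X₁^{i}` in `(a X₀ + b X₁)^m` is `C(m, i) a^{m-i} bⁱ`. [folklore] -/
theorem coeff_expVec_linear_pow (a b : R) (m i : ℕ) (hi : i ≤ m) :
    coeff (expVec m i) ((C a * X 0 + C b * X 1 : MvPolynomial (Fin 2) R) ^ m) =
      (m.choose i : R) * a ^ (m - i) * b ^ i := by
  classical
  rw [add_pow, coeff_sum]
  simp only [mul_pow, ← map_pow]
  have hterm : ∀ k ∈ Finset.range (m + 1),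
      coeff (expVec m i) ((C (a ^ k) * X 0 ^ k) * (C (b ^ (m - k)) * X 1 ^ (m - k)) * (m.choose k : MvPolynomial (Fin 2) R)) =
        if k = m - i then (m.choose i : R) * a ^ (m - i) * b ^ i else 0 := by
    intro k hk
    have hk' : k ≤ m := Nat.lt_succ_iff.mp (Finset.mem_range.mp hk)
    have hmono : (C (a ^ k) * X 0 ^ k) * (C (b ^ (m - k)) * X 1 ^ (m - k)) * (m.choose k : MvPolynomial (Fin 2) R) =
        C (a ^ k * b ^ (m - k) * (m.choose k : R)) * monomial (expVec m (m - k)) 1 := by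
      rw [← X_pow_mul_X_pow_eq_monomial, show m - (m - k) = k by omega]
      simp only [map_mul, map_natCast]
      ring
    rw [hmono, coeff_C_mul, coeff_monomial]
    by_cases hkm : k = m - i
    · subst hkm
      rw [if_pos (by rw [show m - (m - i) = i by omega]), if_pos rfl, show m - (m - i) = i by omega,
        Nat.choose_symm hi]
      ring
    · rw [if_neg, if_neg hkm, mul_zero]
      intro h
      have := expVec_injective m h
      omega
  rw [Finset.sum_congr rfl hterm, Finset.sum_ite_eq' (Finset.range (m + 1)) (m - i), if_pos]
  exact Finset.mem_range.mpr (by omega)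

/-- **The `u^n`-row of `symPow n M` for `M₁₀ = 0`**: `symPow n M 0 j = [j = 0] · M₀₀^n`. [folklore] -/
theorem symPow_apply_zero_of_apply_one_zero {M : Matrix (Fin 2) (Fin 2) R} (hM : M 1 0 = 0)
    (j : Fin (n + 1)) : symPow n M 0 j = if (j : ℕ) = 0 then M 0 0 ^ n else 0 := by
  classical
  rw [symPow, linSubst_monomial_of_apply_one_zero hM, coeff_monomial_mul']
  by_cases hj : (j : ℕ) = 0
  · rw [if_pos hj, hj, Finsupp.single_zero, if_pos (by simp), pow_zero, one_mul, tsub_zero,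
      Nat.sub_zero]
    have h := coeff_expVec_linear_pow (M 0 0) (M 0 1) n 0 (Nat.zero_le n)
    rw [show ((0 : Fin (n + 1)) : ℕ) = 0 from rfl, h]
    simp
  · rw [if_neg hj, if_neg]
    intro hle
    have h1 := hle 1
    simp only [Finsupp.single_eq_same, expVec_apply_one] at h1
    exact hj (Nat.le_zero.mp (h1.trans (le_of_eq rfl)))

/-- **Contraction, first half**: for `M₁₀ = 0` the `u^n`-coefficient of `symPow n M a` is
`M₀₀^n a₀` (the projection to the `u^n`-coefficient is equivariant for upper triangular matrices,
with character `M₀₀^n`). [cite: Hida2022EMI, §4.2.11 (4.40) and the injection `I = i_*`] -/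
theorem symPow_mulVec_apply_zero {M : Matrix (Fin 2) (Fin 2) R} (hM : M 1 0 = 0)
    (a : Fin (n + 1) → R) : (symPow n M *ᵥ a) 0 = M 0 0 ^ n * a 0 := by
  classical
  rw [Matrix.mulVec, dotProduct]
  simp only [symPow_apply_zero_of_apply_one_zero hM, ite_mul, zero_mul]
  rw [Finset.sum_ite, Finset.sum_const_zero, add_zero]
  have : (Finset.univ.filter fun j : Fin (n + 1) ↦ (j : ℕ) = 0) = {0} := by
    ext j
    simp only [Finset.mem_filter, Finset.mem_univ, true_and, Finset.mem_singleton]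
    exact ⟨fun h ↦ Fin.ext h, fun h ↦ by rw [h]; rfl⟩
  rw [this, Finset.sum_singleton]

/-- **Contraction, second half**: if the whole second row of `M` vanishes (`M₁₀ = M₁₁ = 0`, the
shape of `(1 j; 0 p)` modulo `p`), then `symPow n M a = a₀ · (C(n,i) M₀₀^{n-i} M₀₁^{i})ᵢ` depends
on `a` only through its `u^n`-coefficient; in particular it vanishes when `a₀ = 0`.
[cite: Hida2022EMI, §4.2.11 (4.40) and the injection `I = i_*`] -/
theorem symPow_mulVec_of_row_one_eq_zero {M : Matrix (Fin 2) (Fin 2) R} (h10 : M 1 0 = 0)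
    (h11 : M 1 1 = 0) (a : Fin (n + 1) → R) :
    symPow n M *ᵥ a = a 0 • fun i : Fin (n + 1) ↦ (n.choose i : R) * M 0 0 ^ (n - i) * M 0 1 ^ (i : ℕ) := by
  classical
  have hcol : ∀ (i j : Fin (n + 1)), symPow n M i j =
      if (j : ℕ) = 0 then (n.choose i : R) * M 0 0 ^ (n - i) * M 0 1 ^ (i : ℕ) else 0 := by
    intro i j
    rw [symPow, linSubst_monomial_of_apply_one_zero h10, h11]
    by_cases hj : (j : ℕ) = 0
    · rw [if_pos hj, hj, pow_zero, Nat.sub_zero, Finsupp.single_zero, ← C_apply, C_1, one_mul]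
      exact coeff_expVec_linear_pow _ _ n i (by have := i.2; omega)
    · rw [if_neg hj, zero_pow hj, monomial_zero, zero_mul, coeff_zero]
  funext i
  rw [Matrix.mulVec, dotProduct]
  simp only [hcol, ite_mul, zero_mul, Finset.sum_ite, Finset.sum_const_zero, add_zero]
  have : (Finset.univ.filter fun j : Fin (n + 1) ↦ (j : ℕ) = 0) = {0} := by
    ext j
    simp only [Finset.mem_filter, Finset.mem_univ, true_and, Finset.mem_singleton]
    exact ⟨fun h ↦ Fin.ext h, fun h ↦ by rw [h]; rfl⟩
  rw [this, Finset.sum_singleton]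
  simp [mul_comm]

/-- In particular such an `M` kills the forms with vanishing `u^n`-coefficient. [cite: Hida2022EMI, §4.2.11] -/
theorem symPow_mulVec_eq_zero_of_apply_zero_eq_zero {M : Matrix (Fin 2) (Fin 2) R} (h10 : M 1 0 = 0)
    (h11 : M 1 1 = 0) {a : Fin (n + 1) → R} (ha : a 0 = 0) : symPow n M *ᵥ a = 0 := by
  rw [symPow_mulVec_of_row_one_eq_zero h10 h11, ha, zero_smul]

/-- And it fixes the `u^n`-coefficient when moreover `M₀₀ = 1`. [cite: Hida2022EMI, §4.2.11] -/
theorem symPow_mulVec_apply_zero_of_row_one_eq_zero {M : Matrix (Fin 2) (Fin 2) R} (h10 : M 1 0 = 0)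
    (h00 : M 0 0 = 1) (a : Fin (n + 1) → R) : (symPow n M *ᵥ a) 0 = a 0 := by
  rw [symPow_mulVec_apply_zero h10, h00, one_pow, one_mul]

/-- In degree `0` every `symPow` is the identity `1 × 1` matrix. [folklore] -/
theorem symPow_zero_eq_one (M : Matrix (Fin 2) (Fin 2) R) : symPow 0 M = 1 := by
  ext i j
  have hi : i = 0 := Fin.ext (by have := i.2; omega)
  have hj : j = 0 := Fin.ext (by have := j.2; omega)
  subst hi hj
  simp [symPow, expVec, linSubst]

end Literature.NumberTheory.EllipticCurves.ModularForms.HidaCohomology
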